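import Mathlib
import HarnessLib
import Summits.Ventures.LatticeQCDFlow.Scoring.MarkovChainSLLN
import Summits.Ventures.LatticeQCDFlow.Scoring.IndepMHRegenerativeSigma
import Summits.Ventures.LatticeQCDFlow.Scoring.FlowSamplerRegenerative
import Summits.Ventures.LatticeQCDFlow.Scoring.RestartChainRegenerative

/-!
# Strong laws for time averages, instances: independence Metropolis, the exact flow sampler on
# `SU(n)^E` (unconditional), and the non-equilibrium restart chain — from any initial law

HONEST FRAMING: exact (Metropolis-corrected) sampling algorithms for lattice gauge theory;
figures of merit are autocorrelation/cost numbers at stated couplings and volumes; no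
continuum-physics claim.

Venture `LatticeQCDFlow` (cell pub-lqcd), topic `Scoring`; FANOUT row 8 (`s0-cpn-nemc`, GEN-18).
NEW WORK of the cell, not a published result; no definition is introduced.  Three compositions of
`Scoring/MarkovChainSLLN.markovChain_slln` with the tree's Doeblin certificates:
`Exactness.indepMH_exact_doeblin_of_density_ratio` (IMH with log-weight oscillation `≤ M`),
`Exactness.flowSampler_exact_doeblin` (the exact flow sampler, UNCONDITIONAL), and
`Scoring/RestartTimeAverage.restart_doeblin` (row 8's restart chain).  In each case: for every
bounded measurable observable and EVERY initial law, the plain time average converges almost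
surely to the target expectation — strong consistency of the exact samplers' estimates, with no
warm-start or stationarity assumption.  Printed counterpart NAMED ONLY: the ergodic theorem for
Harris chains (Meyn–Tweedie 1993 Thm 17.0.1) — nothing is cited as a fact.

## Content

* **`indepMH_timeAverage_slln`**, **`flowSampler_timeAverage_slln`**, **`restart_timeAverage_slln`**.

NOT CLAIMED: rates; unbounded observables; any `M`, `δ`, `ε₀` of a concrete sampler.
-/

noncomputable section

namespace Summit.Ventures.LatticeQCDFlow.Scoring

open MeasureTheory ProbabilityTheory Filter Finset Summit.Ventures.LatticeQCDFlow.Exactness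
open Literature.MathematicalPhysics.QuantumFieldTheory
open Literature.MathematicalPhysics.QuantumFieldTheory.Luscher2010
open Summit.Ventures.LatticeQCDFlow.TrivializingMaps
open Literature.Probability.MarkovChains
open scoped ENNReal Matrix Matrix.Norms.Frobenius ContDiff Topology

section IndepMH

variable {Ω : Type*} [MeasurableSpace Ω]

/-- **Strong law for independence Metropolis with log-weight oscillation `≤ M`**, any initial law:
a.s. `(Σ_{t<n} f(X_t))/n → π(f)`. -/
theorem indepMH_timeAverage_slln {π q : Measure Ω} [IsProbabilityMeasure π]
    [IsProbabilityMeasure q] {ρ : Ω → ℝ} (hρm : Measurable ρ) (hρ0 : ∀ x, 0 < ρ x)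
    (hq : q = π.withDensity fun x => ENNReal.ofReal (ρ x)) {M : ℝ} (hM0 : 0 < M)
    (hM : ∀ x y, ρ x ≤ Real.exp M * ρ y)
    {f : Ω → ℝ} (hf : Measurable f) {C : ℝ} (hC : ∀ x, |f x| ≤ C)
    (μ₀ : Measure Ω) [IsProbabilityMeasure μ₀] :
    haveI : Fact (Measurable fun x => (ρ x)⁻¹) := ⟨hρm.inv⟩
    ∀ᵐ y ∂(Kernel.trajMeasure (X := fun _ : ℕ => Ω) μ₀
        (fun j : ℕ => (indepMH q fun x => (ρ x)⁻¹).comap (fun h : (i : ↥(Finset.Iic j)) → Ω => h ⟨j, Finset.mem_Iic.2 le_rfl⟩)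
          (measurable_pi_apply _))),
      Tendsto (fun n : ℕ => (∑ t ∈ Finset.range n, f (y t)) / n) atTop (𝓝 (∫ z, f z ∂π)) := by
  haveI : Fact (Measurable fun x => (ρ x)⁻¹) := ⟨hρm.inv⟩
  obtain ⟨hinv, -, hdoeb⟩ := indepMH_exact_doeblin_of_density_ratio hρm hρ0 hq hM
  have hε0 : 0 < ENNReal.ofReal (Real.exp (-M)) := ENNReal.ofReal_pos.2 (Real.exp_pos _)
  have hε1 : ENNReal.ofReal (Real.exp (-M)) < 1 := by
    rw [ENNReal.ofReal_lt_one]; exact Real.exp_lt_one_iff.2 (by linarith)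
  exact markovChain_slln (κ := indepMH q fun x => (ρ x)⁻¹) (ν := π) hinv (fun x _ hB => hdoeb x hB)
    hε0 hε1 hf hC μ₀

end IndepMH

section Flow

variable {d L n : ℕ} [NeZero L]

/-- **Strong law for the exact flow sampler on `SU(n)^E` — UNCONDITIONAL, any initial configuration
law**: with the weight `w` of `Exactness.flowSampler_exact_doeblin`, the flow-MCMC time averages of
every bounded measurable observable converge almost surely to its Boltzmann expectation. -/
theorem flowSampler_timeAverage_slln (B : SuBasis n)
    {S : AmbConfig d L n → ℝ} (hS : ContDiff ℝ ∞ S) {F : ℝ → AmbConfig d L n → ℝ}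
    (hF : ContDiff ℝ ∞ fun p : ℝ × AmbConfig d L n => F p.1 p.2)
    {Φ : ℝ → GaugeConfig d L (Matrix.specialUnitaryGroup (Fin n) ℂ) → GaugeConfig d L (Matrix.specialUnitaryGroup (Fin n) ℂ)}
    (hΦ : IsFlowMap (fun t W => -linkGrad B (F t) W) Φ) {c : ℝ → ℝ} {δ : ℝ} (hδ0 : 0 < δ)
    (hδ : ∀ t ∈ Set.Icc (0 : ℝ) 1, ∀ U : GaugeConfig d L (Matrix.specialUnitaryGroup (Fin n) ℂ),
      |luscherL B S t (F t) (WilsonFlow.coeConfig U) - S (WilsonFlow.coeConfig U) - c t| ≤ δ)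
    (q : Measure (GaugeConfig d L (Matrix.specialUnitaryGroup (Fin n) ℂ))) [IsProbabilityMeasure q]
    (hq : q = Measure.map (Φ 1) (trivialMeasure (Matrix.specialUnitaryGroup (Fin n) ℂ) d L)) :
    ∃ w : GaugeConfig d L (Matrix.specialUnitaryGroup (Fin n) ℂ) → ℝ, ∃ hw : Measurable w,
      (q.withDensity fun U => ENNReal.ofReal (w U)) = (boltzmannMeasure fun U : GaugeConfig d L (Matrix.specialUnitaryGroup (Fin n) ℂ) => S (WilsonFlow.coeConfig U)) ∧
      Kernel.Invariant (indepMH q w) (boltzmannMeasure fun U : GaugeConfig d L (Matrix.specialUnitaryGroup (Fin n) ℂ) => S (WilsonFlow.coeConfig U)) ∧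
      haveI : Fact (Measurable w) := ⟨hw⟩
      ∀ (μ₀ : Measure (GaugeConfig d L (Matrix.specialUnitaryGroup (Fin n) ℂ))) [IsProbabilityMeasure μ₀] (f : GaugeConfig d L (Matrix.specialUnitaryGroup (Fin n) ℂ) → ℝ), Measurable f →
        ∀ C : ℝ, (∀ U, |f U| ≤ C) →
        ∀ᵐ y ∂(Kernel.trajMeasure (X := fun _ : ℕ => GaugeConfig d L (Matrix.specialUnitaryGroup (Fin n) ℂ)) μ₀
        (fun j : ℕ => (indepMH q w).comap (fun h : (i : ↥(Finset.Iic j)) → GaugeConfig d L (Matrix.specialUnitaryGroup (Fin n) ℂ) => h ⟨j, Finset.mem_Iic.2 le_rfl⟩)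
          (measurable_pi_apply _))),
          Tendsto (fun m : ℕ => (∑ t ∈ Finset.range m, f (y t)) / m) atTop
            (𝓝 (∫ V, f V ∂(boltzmannMeasure fun U : GaugeConfig d L (Matrix.specialUnitaryGroup (Fin n) ℂ) => S (WilsonFlow.coeConfig U)))) := by
  obtain ⟨w, hw, -, -, hπ, hinv, -, hdoeb⟩ := flowSampler_exact_doeblin B hS hF hΦ hδ q hq
  haveI : Fact (Measurable w) := ⟨hw⟩
  have hS'c : Continuous fun U : GaugeConfig d L (Matrix.specialUnitaryGroup (Fin n) ℂ) => S (WilsonFlow.coeConfig U) :=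
    hS.continuous.comp WilsonFlow.continuous_coeConfig
  haveI := isProbabilityMeasure_boltzmannMeasure (d := d) (L := L) hS'c
  have hε0 : 0 < ENNReal.ofReal (Real.exp (-(2 * δ))) := ENNReal.ofReal_pos.2 (Real.exp_pos _)
  have hε1 : ENNReal.ofReal (Real.exp (-(2 * δ))) < 1 := by
    rw [ENNReal.ofReal_lt_one]; exact Real.exp_lt_one_iff.2 (by linarith)
  exact ⟨w, hw, hπ, hinv, fun μ₀ _ f hf C hC =>
    markovChain_slln (κ := indepMH q w) (ν := (boltzmannMeasure fun U : GaugeConfig d L (Matrix.specialUnitaryGroup (Fin n) ℂ) => S (WilsonFlow.coeConfig U))) hinv (fun U _ hA => hdoeb U hA) hε0 hε1 hf hC μ₀⟩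

end Flow

section Restart

variable {Ω E : Type*} [MeasurableSpace Ω] [MeasurableSpace E]
  {κ₀ : Kernel Ω Ω} [IsMarkovKernel κ₀] {κF : Kernel Ω E} [IsMarkovKernel κF]
  {π₀ : Measure Ω} [IsProbabilityMeasure π₀] {ε : ℝ≥0∞}

/-- **Strong law for time averages of a record observable along the restart chain**, any start:
a.s. `(Σ_{t<n} G(x_t, ω_t))/n → Π(G)` with `Π = π₀ ⊗ₘ κF`. -/
theorem restart_timeAverage_slln (hπ₀ : Kernel.Invariant κ₀ π₀)
    (hmin : ∀ x {B : Set Ω}, MeasurableSet B → ε * π₀ B ≤ κ₀ x B) (hε0 : 0 < ε) (hε : ε < 1)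
    {G : Ω × E → ℝ} (hG : Measurable G) {C : ℝ} (hC : ∀ p, |G p| ≤ C)
    (μ₀ : Measure (Ω × E)) [IsProbabilityMeasure μ₀] :
    ∀ᵐ y ∂(Kernel.trajMeasure (X := fun _ : ℕ => Ω × E) μ₀
        (fun j : ℕ => (((Kernel.prodMkRight E κ₀) ⊗ₖ (Kernel.prodMkLeft (Ω × E) κF))).comap (fun h : (i : ↥(Finset.Iic j)) → Ω × E => h ⟨j, Finset.mem_Iic.2 le_rfl⟩)
          (measurable_pi_apply _))),
      Tendsto (fun n : ℕ => (∑ t ∈ Finset.range n, G (y t)) / n) atTop (𝓝 (∫ p, G p ∂(π₀ ⊗ₘ κF))) :=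
  markovChain_slln (κ := ((Kernel.prodMkRight E κ₀) ⊗ₖ (Kernel.prodMkLeft (Ω × E) κF))) (ν := π₀ ⊗ₘ κF) (invariant_restart hπ₀)
    (fun p _ hS => restart_doeblin (κF := κF) hmin p hS) hε0 hε hG hC μ₀

end Restart

end Summit.Ventures.LatticeQCDFlow.Scoring

end
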